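import Summits.CriticalPhenomena.PercolationContinuityZ3.Theorems.PercNearOneGluingNoHeavyQuantLawDecUsageMongeRates
import HarnessLib

/-!
# QUANT lane R8, T-DEC: the SOUTH-WEST GREEDY CREDIT FLOW (abstract Monge transportation with gains) — definition, validity,
# and the PREFIX PROPERTY (lead g25, `run/shared/lean/prim/quant/FOR-PROVERS-WINDOW-ATOMS.md` §2, Lean plan W2 part 1)

builds on p205010 (kernel theorem, internal audit signed; external expert review pending)

Support file (`--supports stmt-CriticalPhenomena-4575`), QUANT lane lead seat (gen 25), rung R8 of
`run/shared/lean/prim/quant/LADDER.md`.  Definitions + theorems, standard axioms, no sorries.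

THE SETTING (abstracting the flow form `LawDec.FlowAtT` of DEC(j′), `…QuantLawDecFlows`, at the TOP layer of a window).  Rows
("lows") and columns ("mids") are natural numbers; a compatibility relation `P l h` (for DEC: `T < l + h`) and rates `u l h > 0`
(for DEC: `LawDec.usage x T j l h`); a row `l` carries mass `μ l`, a column `h` has capacity `c h`; a CREDIT FLOW ships `f l h ≥ 0`
along compatible cells, at most `μ l` out of each row, loading column `h` by `Σ_l u l h · f l h ≤ c h` (`Greedy.IsFlow`).  The
SOUTH-WEST GREEDY flow (`Greedy.rowFill`, `Greedy.flow`): rows in DECREASING order, each filling its compatible columns in INCREASING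
order to exhaustion (Hoffman's corner rule for Monge arrays; lead g21's `…QuantLawDecUsageMonge` proved the DEC rates are Monge).
This file: the recursive definitions, their unfolding lemmas, validity of the greedy flow, and the PREFIX PROPERTY
(`Greedy.flow_prefix`: the greedy flow on the columns `≤ t` does not depend on the columns `> t`) — the reason ONE universal flow
serves every layer of a window.  Part 2 (`…QuantGreedyOptimal`): the greedy value dominates every credit flow (exchange /
value-function induction by the Monge inequality), hence is optimal on every prefix of columns simultaneously.

* `Greedy.IsFlow u P L H μ c f` — credit flow on rows `L`, columns `H`.   `Greedy.val L H f = Σ_{l∈L} Σ_{h∈H} f l h`.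
* `Greedy.rowFill u P l k H c rem` — mass the row `l` (with `rem` left to ship) puts into column `k` when filling `H` upwards.
* `Greedy.flow u P L H μ c l k` — the SW greedy flow (recursion on `L.max'`).
* row/flow bookkeeping lemmas, **`Greedy.isFlow_flow`**, **`Greedy.flow_prefix`**.

[this work]; Monge rates: lead g21 (this lane); corner rules for Monge arrays are classical (Hoffman 1963; Burkard–Klinz–Rudolf 1996).
The gluing rows served [cite: KozmaNitzan2024, Conjecture 3 (p. 15)]; product measure [cite: Grimmett1999, §1.3 p. 10]. -/
noncomputable section
namespace Summit.CriticalPhenomena.PercolationContinuityZ3.Theorems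
namespace Quant
namespace LawDec
namespace Greedy

open Finset
variable (u : ℕ → ℕ → ℝ) (P : ℕ → ℕ → Prop) [DecidableRel P]

/-- **credit flow** on rows `L`, columns `H`, row masses `μ`, column capacities `c`, rates `u`, compatibility `P`:
nonnegative, supported on compatible cells of `L × H`, ships at most `μ l` from row `l`, loads column `h` by at most `c h`. [this work] -/
def IsFlow (L H : Finset ℕ) (μ c : ℕ → ℝ) (f : ℕ → ℕ → ℝ) : Prop :=
  (∀ l h, 0 ≤ f l h) ∧ (∀ l h, f l h ≠ 0 → l ∈ L ∧ h ∈ H ∧ P l h) ∧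
    (∀ l ∈ L, ∑ h ∈ H, f l h ≤ μ l) ∧ (∀ h ∈ H, ∑ l ∈ L, u l h * f l h ≤ c h)

/-- total mass shipped by `f` on `L × H`. [this work] -/
def val (L H : Finset ℕ) (f : ℕ → ℕ → ℝ) : ℝ := ∑ l ∈ L, ∑ h ∈ H, f l h

/-- **greedy fill of one row**: the mass that row `l`, with `rem` still to ship, puts into column `k` when it fills the columns of
`H` in increasing order, each compatible column `h` receiving `min(remaining, c h / u l h)`. [this work] -/
def rowFill (l k : ℕ) (H : Finset ℕ) (c : ℕ → ℝ) (rem : ℝ) : ℝ :=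
  if hH : H.Nonempty then
    if k = H.min' hH then (if P l (H.min' hH) then min rem (c (H.min' hH) / u l (H.min' hH)) else 0)
    else rowFill l k (H.erase (H.min' hH)) c
      (rem - (if P l (H.min' hH) then min rem (c (H.min' hH) / u l (H.min' hH)) else 0))
  else 0
termination_by H.card
decreasing_by exact Finset.card_erase_lt_of_mem (Finset.min'_mem H hH)

/-- the amount the row puts into the first column of `H`. [this work] -/
def firstFill (l : ℕ) (H : Finset ℕ) (hH : H.Nonempty) (c : ℕ → ℝ) (rem : ℝ) : ℝ :=
  if P l (H.min' hH) then min rem (c (H.min' hH) / u l (H.min' hH)) else 0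

/-- no columns, no fill. [this work] -/
theorem rowFill_empty (l k : ℕ) (c : ℕ → ℝ) (rem : ℝ) : rowFill u P l k ∅ c rem = 0 := by
  rw [rowFill]; simp
/-- unfolding at the least column. [this work] -/
theorem rowFill_eq (l k : ℕ) (H : Finset ℕ) (hH : H.Nonempty) (c : ℕ → ℝ) (rem : ℝ) :
    rowFill u P l k H c rem =
      if k = H.min' hH then firstFill u P l H hH c rem
      else rowFill u P l k (H.erase (H.min' hH)) c (rem - firstFill u P l H hH c rem) := by
  rw [rowFill, dif_pos hH]; rfl

/-- the least column receives `firstFill`. [this work] -/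
theorem rowFill_min' (l : ℕ) (H : Finset ℕ) (hH : H.Nonempty) (c : ℕ → ℝ) (rem : ℝ) :
    rowFill u P l (H.min' hH) H c rem = firstFill u P l H hH c rem := by
  rw [rowFill_eq u P l _ H hH, if_pos rfl]
/-- the other columns are filled by the recursive call. [this work] -/
theorem rowFill_of_ne_min' (l k : ℕ) (H : Finset ℕ) (hH : H.Nonempty) (c : ℕ → ℝ) (rem : ℝ) (hk : k ≠ H.min' hH) :
    rowFill u P l k H c rem = rowFill u P l k (H.erase (H.min' hH)) c (rem - firstFill u P l H hH c rem) := by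
  rw [rowFill_eq u P l k H hH, if_neg hk]

/-- `firstFill ≥ 0`. [this work] -/
theorem firstFill_nonneg (l : ℕ) (H : Finset ℕ) (hH : H.Nonempty) (c : ℕ → ℝ) (rem : ℝ) (hrem : 0 ≤ rem)
    (hc : 0 ≤ c (H.min' hH)) (hu : P l (H.min' hH) → 0 < u l (H.min' hH)) : 0 ≤ firstFill u P l H hH c rem := by
  unfold firstFill
  split_ifs with hP
  · exact le_min hrem (div_nonneg hc (hu hP).le)
  · exact le_rfl

/-- `firstFill ≤ rem`. [this work] -/
theorem firstFill_le_rem (l : ℕ) (H : Finset ℕ) (hH : H.Nonempty) (c : ℕ → ℝ) (rem : ℝ) (hrem : 0 ≤ rem) :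
    firstFill u P l H hH c rem ≤ rem := by
  unfold firstFill
  split_ifs
  · exact min_le_left _ _
  · exact hrem

/-- `rowFill` vanishes outside `H`. [this work] -/
theorem rowFill_eq_zero_of_not_mem (l : ℕ) : ∀ (H : Finset ℕ) (k : ℕ) (c : ℕ → ℝ) (rem : ℝ), k ∉ H →
    rowFill u P l k H c rem = 0 := by
  intro H
  induction H using Finset.strongInduction with
  | H H ih =>
    intro k c rem hk
    by_cases hH : H.Nonempty
    · have hne : k ≠ H.min' hH := fun h => hk (h ▸ Finset.min'_mem H hH)
      rw [rowFill_of_ne_min' u P l k H hH c rem hne]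
      exact ih _ (Finset.erase_ssubset (Finset.min'_mem H hH)) k c _ (fun h => hk (Finset.mem_of_mem_erase h))
    · rw [Finset.not_nonempty_iff_eq_empty.1 hH, rowFill_empty]

/-- `rowFill` vanishes on incompatible columns. [this work] -/
theorem rowFill_eq_zero_of_not_rel (l : ℕ) : ∀ (H : Finset ℕ) (k : ℕ) (c : ℕ → ℝ) (rem : ℝ), ¬ P l k →
    rowFill u P l k H c rem = 0 := by
  intro H
  induction H using Finset.strongInduction with
  | H H ih =>
    intro k c rem hk
    by_cases hH : H.Nonempty
    · by_cases hkm : k = H.min' hH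
      · subst hkm; rw [rowFill_min']; unfold firstFill; rw [if_neg hk]
      · rw [rowFill_of_ne_min' u P l k H hH c rem hkm]
        exact ih _ (Finset.erase_ssubset (Finset.min'_mem H hH)) k c _ hk
    · rw [Finset.not_nonempty_iff_eq_empty.1 hH, rowFill_empty]

/-- `rowFill ≥ 0` (nonnegative data). [this work] -/
theorem rowFill_nonneg (l : ℕ) (hu : ∀ h, P l h → 0 < u l h) : ∀ (H : Finset ℕ) (k : ℕ) (c : ℕ → ℝ) (rem : ℝ),
    0 ≤ rem → (∀ h ∈ H, 0 ≤ c h) → 0 ≤ rowFill u P l k H c rem := by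
  intro H
  induction H using Finset.strongInduction with
  | H H ih =>
    intro k c rem hrem hc
    by_cases hH : H.Nonempty
    · have h0 := firstFill_nonneg u P l H hH c rem hrem (hc _ (Finset.min'_mem H hH)) (hu _)
      by_cases hkm : k = H.min' hH
      · subst hkm; rw [rowFill_min']; exact h0
      · rw [rowFill_of_ne_min' u P l k H hH c rem hkm]
        refine ih _ (Finset.erase_ssubset (Finset.min'_mem H hH)) k c _ ?_ (fun h hh => hc h (Finset.mem_of_mem_erase hh))
        linarith [firstFill_le_rem u P l H hH c rem hrem]
    · rw [Finset.not_nonempty_iff_eq_empty.1 hH, rowFill_empty]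

/-- **capacity**: `u l k · rowFill ≤ c k` on compatible columns (nonnegative data). [this work] -/
theorem mul_rowFill_le (l : ℕ) (hu : ∀ h, P l h → 0 < u l h) : ∀ (H : Finset ℕ) (k : ℕ) (c : ℕ → ℝ) (rem : ℝ),
    0 ≤ rem → (∀ h ∈ H, 0 ≤ c h) → k ∈ H → u l k * rowFill u P l k H c rem ≤ c k := by
  intro H
  induction H using Finset.strongInduction with
  | H H ih =>
    intro k c rem hrem hc hk
    have hH : H.Nonempty := ⟨k, hk⟩
    by_cases hkm : k = H.min' hH
    · subst hkm
      rw [rowFill_min']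
      unfold firstFill
      split_ifs with hP
      · have hu' := hu _ hP
        calc u l (H.min' hH) * min rem (c (H.min' hH) / u l (H.min' hH))
            ≤ u l (H.min' hH) * (c (H.min' hH) / u l (H.min' hH)) :=
              mul_le_mul_of_nonneg_left (min_le_right _ _) hu'.le
          _ = c (H.min' hH) := by field_simp
      · rw [mul_zero]; exact hc _ (Finset.min'_mem H hH)
    · rw [rowFill_of_ne_min' u P l k H hH c rem hkm]
      refine ih _ (Finset.erase_ssubset (Finset.min'_mem H hH)) k c _ ?_ (fun h hh => hc h (Finset.mem_of_mem_erase hh))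
        (Finset.mem_erase.2 ⟨hkm, hk⟩)
      linarith [firstFill_le_rem u P l H hH c rem hrem]

/-- **the row ships at most `rem`**: `Σ_{k∈H} rowFill = rem − leftover ≤ rem`. [this work] -/
theorem sum_rowFill_le (l : ℕ) : ∀ (H : Finset ℕ) (c : ℕ → ℝ) (rem : ℝ),
    0 ≤ rem → (∀ h ∈ H, 0 ≤ c h) → ∑ k ∈ H, rowFill u P l k H c rem ≤ rem := by
  intro H
  induction H using Finset.strongInduction with
  | H H ih =>
    intro c rem hrem hc
    by_cases hH : H.Nonempty
    · have hm := Finset.min'_mem H hH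
      rw [← Finset.add_sum_erase H _ hm, rowFill_min']
      have hrest : ∑ k ∈ H.erase (H.min' hH), rowFill u P l k H c rem =
          ∑ k ∈ H.erase (H.min' hH), rowFill u P l k (H.erase (H.min' hH)) c (rem - firstFill u P l H hH c rem) :=
        Finset.sum_congr rfl fun k hk => rowFill_of_ne_min' u P l k H hH c rem (Finset.ne_of_mem_erase hk)
      rw [hrest]
      have h1 := firstFill_le_rem u P l H hH c rem hrem
      have h2 := ih _ (Finset.erase_ssubset hm) c (rem - firstFill u P l H hH c rem) (by linarith)
        (fun h hh => hc h (Finset.mem_of_mem_erase hh))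
      linarith
    · rw [Finset.not_nonempty_iff_eq_empty.1 hH]; simp [hrem]

/-- **prefix property of one row**: on columns `k ≤ t`, `rowFill` over `H` agrees with `rowFill` over `H.filter (· ≤ t)` and does
not depend on the capacities of the columns `> t`. [this work] -/
theorem rowFill_prefix (l t : ℕ) : ∀ (H : Finset ℕ) (k : ℕ) (c c' : ℕ → ℝ) (rem : ℝ), k ≤ t →
    (∀ h ∈ H, h ≤ t → c h = c' h) →
    rowFill u P l k H c rem = rowFill u P l k (H.filter (· ≤ t)) c' rem := by
  intro H
  induction H using Finset.strongInduction with
  | H H ih =>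
    intro k c c' rem hkt hcc
    by_cases hH : H.Nonempty
    · set h := H.min' hH with hh
      by_cases hht : h ≤ t
      · -- the least column survives the filter and is its minimum
        have hmemf : h ∈ H.filter (· ≤ t) := Finset.mem_filter.2 ⟨Finset.min'_mem H hH, hht⟩
        have hHf : (H.filter (· ≤ t)).Nonempty := ⟨h, hmemf⟩
        have hminf : (H.filter (· ≤ t)).min' hHf = h := by
          refine le_antisymm (Finset.min'_le _ _ hmemf) ?_
          exact Finset.le_min' _ _ _ fun y hy => Finset.min'_le H y (Finset.mem_of_mem_filter y hy)
        have hff : firstFill u P l H hH c rem = firstFill u P l (H.filter (· ≤ t)) hHf c' rem := by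
          unfold firstFill; rw [hminf, ← hh, hcc h (Finset.min'_mem H hH) hht]
        by_cases hk : k = h
        · have e1 : rowFill u P l h H c rem = firstFill u P l H hH c rem := by rw [hh]; exact rowFill_min' u P l H hH c rem
          have e2 := rowFill_min' u P l (H.filter (· ≤ t)) hHf c' rem
          rw [hminf] at e2
          rw [hk, e1, e2, hff]
        · rw [rowFill_of_ne_min' u P l k H hH c rem (by rwa [← hh]),
            rowFill_of_ne_min' u P l k _ hHf c' rem (by rwa [hminf]), hminf, ← hh, hff]
          have hfe : (H.erase h).filter (· ≤ t) = (H.filter (· ≤ t)).erase h := Finset.filter_erase _ _ _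
          rw [← hfe]
          exact ih _ (Finset.erase_ssubset (Finset.min'_mem H hH)) k c c' _ hkt
            (fun y hy hyt => hcc y (Finset.mem_of_mem_erase hy) hyt)
      · -- the least column is above `t`: every column is, both sides vanish
        have hkH : k ∉ H := fun hkH => hht ((Finset.min'_le H k hkH).trans hkt)
        have hkF : k ∉ H.filter (· ≤ t) := fun hkF => hkH (Finset.mem_of_mem_filter k hkF)
        rw [rowFill_eq_zero_of_not_mem u P l H k c rem hkH, rowFill_eq_zero_of_not_mem u P l _ k c' rem hkF]
    · rw [Finset.not_nonempty_iff_eq_empty.1 hH]; simp [rowFill_empty]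

/-- **the SOUTH-WEST GREEDY CREDIT FLOW**: the largest row `l = L.max'` fills the columns by `rowFill` with its whole mass `μ l`;
the remaining rows recurse on the residual capacities `c h − u l h · rowFill`. [this work] -/
def flow (L H : Finset ℕ) (μ c : ℕ → ℝ) (l k : ℕ) : ℝ :=
  if hL : L.Nonempty then
    if l = L.max' hL then rowFill u P (L.max' hL) k H c (μ (L.max' hL))
    else flow (L.erase (L.max' hL)) H μ (fun h => c h - u (L.max' hL) h * rowFill u P (L.max' hL) h H c (μ (L.max' hL))) l k
  else 0
termination_by L.card
decreasing_by exact Finset.card_erase_lt_of_mem (Finset.max'_mem L hL)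

/-- residual capacities after the top row. [this work] -/
def resid (L : Finset ℕ) (hL : L.Nonempty) (H : Finset ℕ) (μ c : ℕ → ℝ) : ℕ → ℝ :=
  fun h => c h - u (L.max' hL) h * rowFill u P (L.max' hL) h H c (μ (L.max' hL))

/-- no rows, no flow. [this work] -/
theorem flow_empty (H : Finset ℕ) (μ c : ℕ → ℝ) (l k : ℕ) : flow u P ∅ H μ c l k = 0 := by
  rw [flow]; simp
/-- unfolding at the largest row. [this work] -/
theorem flow_eq (L H : Finset ℕ) (hL : L.Nonempty) (μ c : ℕ → ℝ) (l k : ℕ) :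
    flow u P L H μ c l k =
      if l = L.max' hL then rowFill u P (L.max' hL) k H c (μ (L.max' hL))
      else flow u P (L.erase (L.max' hL)) H μ (resid u P L hL H μ c) l k := by
  rw [flow, dif_pos hL]; rfl

/-- the top row is `rowFill` with its whole mass. [this work] -/
theorem flow_max' (L H : Finset ℕ) (hL : L.Nonempty) (μ c : ℕ → ℝ) (k : ℕ) :
    flow u P L H μ c (L.max' hL) k = rowFill u P (L.max' hL) k H c (μ (L.max' hL)) := by
  rw [flow_eq u P L H hL, if_pos rfl]
/-- the other rows are the recursive call on the residual capacities. [this work] -/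
theorem flow_of_ne_max' (L H : Finset ℕ) (hL : L.Nonempty) (μ c : ℕ → ℝ) (l k : ℕ) (hl : l ≠ L.max' hL) :
    flow u P L H μ c l k = flow u P (L.erase (L.max' hL)) H μ (resid u P L hL H μ c) l k := by
  rw [flow_eq u P L H hL, if_neg hl]

/-- residual capacities stay nonnegative. [this work] -/
theorem resid_nonneg (L : Finset ℕ) (hL : L.Nonempty) (H : Finset ℕ) (μ c : ℕ → ℝ)
    (hu : ∀ l h, P l h → 0 < u l h) (hμ : 0 ≤ μ (L.max' hL)) (hc : ∀ h ∈ H, 0 ≤ c h) :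
    ∀ h ∈ H, 0 ≤ resid u P L hL H μ c h := by
  intro h hh
  unfold resid
  by_cases hP : P (L.max' hL) h
  · have := mul_rowFill_le u P (L.max' hL) (hu _) H h c (μ (L.max' hL)) hμ hc hh
    linarith
  · rw [rowFill_eq_zero_of_not_rel u P (L.max' hL) H h c _ hP, mul_zero, sub_zero]; exact hc h hh

/-- `flow` vanishes outside the rows `L`. [this work] -/
theorem flow_eq_zero_of_not_mem_row : ∀ (L H : Finset ℕ) (μ c : ℕ → ℝ) (l k : ℕ), l ∉ L → flow u P L H μ c l k = 0 := by
  intro L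
  induction L using Finset.strongInduction with
  | H L ih =>
    intro H μ c l k hl
    by_cases hL : L.Nonempty
    · have hne : l ≠ L.max' hL := fun h => hl (h ▸ Finset.max'_mem L hL)
      rw [flow_of_ne_max' u P L H hL μ c l k hne]
      exact ih _ (Finset.erase_ssubset (Finset.max'_mem L hL)) H μ _ l k (fun h => hl (Finset.mem_of_mem_erase h))
    · rw [Finset.not_nonempty_iff_eq_empty.1 hL, flow_empty]

/-- `flow` vanishes outside the columns `H`. [this work] -/
theorem flow_eq_zero_of_not_mem_col : ∀ (L H : Finset ℕ) (μ c : ℕ → ℝ) (l k : ℕ), k ∉ H → flow u P L H μ c l k = 0 := by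
  intro L
  induction L using Finset.strongInduction with
  | H L ih =>
    intro H μ c l k hk
    by_cases hL : L.Nonempty
    · by_cases hlm : l = L.max' hL
      · rw [hlm, flow_max']; exact rowFill_eq_zero_of_not_mem u P _ H k c _ hk
      · rw [flow_of_ne_max' u P L H hL μ c l k hlm]
        exact ih _ (Finset.erase_ssubset (Finset.max'_mem L hL)) H μ _ l k hk
    · rw [Finset.not_nonempty_iff_eq_empty.1 hL, flow_empty]

/-- `flow` vanishes on incompatible cells. [this work] -/
theorem flow_eq_zero_of_not_rel : ∀ (L H : Finset ℕ) (μ c : ℕ → ℝ) (l k : ℕ), ¬ P l k → flow u P L H μ c l k = 0 := by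
  intro L
  induction L using Finset.strongInduction with
  | H L ih =>
    intro H μ c l k hk
    by_cases hL : L.Nonempty
    · by_cases hlm : l = L.max' hL
      · subst hlm; rw [flow_max']; exact rowFill_eq_zero_of_not_rel u P _ H k c _ hk
      · rw [flow_of_ne_max' u P L H hL μ c l k hlm]
        exact ih _ (Finset.erase_ssubset (Finset.max'_mem L hL)) H μ _ l k hk
    · rw [Finset.not_nonempty_iff_eq_empty.1 hL, flow_empty]

/-- `flow ≥ 0` (nonnegative data). [this work] -/
theorem flow_nonneg (hu : ∀ l h, P l h → 0 < u l h) : ∀ (L H : Finset ℕ) (μ c : ℕ → ℝ) (l k : ℕ),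
    (∀ l ∈ L, 0 ≤ μ l) → (∀ h ∈ H, 0 ≤ c h) → 0 ≤ flow u P L H μ c l k := by
  intro L
  induction L using Finset.strongInduction with
  | H L ih =>
    intro H μ c l k hμ hc
    by_cases hL : L.Nonempty
    · have hμm := hμ _ (Finset.max'_mem L hL)
      by_cases hlm : l = L.max' hL
      · rw [hlm, flow_max']; exact rowFill_nonneg u P _ (hu _) H k c _ hμm hc
      · rw [flow_of_ne_max' u P L H hL μ c l k hlm]
        exact ih _ (Finset.erase_ssubset (Finset.max'_mem L hL)) H μ _ l k
          (fun l' hl' => hμ l' (Finset.mem_of_mem_erase hl')) (resid_nonneg u P L hL H μ c hu hμm hc)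
    · rw [Finset.not_nonempty_iff_eq_empty.1 hL, flow_empty]

/-- **rows**: the greedy ships at most `μ l` out of row `l`. [this work] -/
theorem sum_flow_row_le (hu : ∀ l h, P l h → 0 < u l h) : ∀ (L H : Finset ℕ) (μ c : ℕ → ℝ) (l : ℕ),
    (∀ l ∈ L, 0 ≤ μ l) → (∀ h ∈ H, 0 ≤ c h) → l ∈ L → ∑ k ∈ H, flow u P L H μ c l k ≤ μ l := by
  intro L
  induction L using Finset.strongInduction with
  | H L ih =>
    intro H μ c l hμ hc hl
    have hL : L.Nonempty := ⟨l, hl⟩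
    have hμm := hμ _ (Finset.max'_mem L hL)
    by_cases hlm : l = L.max' hL
    · rw [hlm]; simp_rw [flow_max']; exact sum_rowFill_le u P _ H c _ hμm hc
    · simp_rw [flow_of_ne_max' u P L H hL μ c l _ hlm]
      exact ih _ (Finset.erase_ssubset (Finset.max'_mem L hL)) H μ _ l
        (fun l' hl' => hμ l' (Finset.mem_of_mem_erase hl')) (resid_nonneg u P L hL H μ c hu hμm hc) (Finset.mem_erase.2 ⟨hlm, hl⟩)

/-- **columns**: the greedy loads column `k ∈ H` by at most `c k`. [this work] -/
theorem sum_mul_flow_col_le (hu : ∀ l h, P l h → 0 < u l h) : ∀ (L H : Finset ℕ) (μ c : ℕ → ℝ) (k : ℕ),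
    (∀ l ∈ L, 0 ≤ μ l) → (∀ h ∈ H, 0 ≤ c h) → k ∈ H → ∑ l ∈ L, u l k * flow u P L H μ c l k ≤ c k := by
  intro L
  induction L using Finset.strongInduction with
  | H L ih =>
    intro H μ c k hμ hc hk
    by_cases hL : L.Nonempty
    · have hm := Finset.max'_mem L hL
      have hμm := hμ _ hm
      rw [← Finset.add_sum_erase L _ hm, flow_max']
      have hrest : ∑ l ∈ L.erase (L.max' hL), u l k * flow u P L H μ c l k =
          ∑ l ∈ L.erase (L.max' hL), u l k * flow u P (L.erase (L.max' hL)) H μ (resid u P L hL H μ c) l k :=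
        Finset.sum_congr rfl fun l hl => by rw [flow_of_ne_max' u P L H hL μ c l k (Finset.ne_of_mem_erase hl)]
      rw [hrest]
      have h2 := ih _ (Finset.erase_ssubset hm) H μ (resid u P L hL H μ c) k
        (fun l' hl' => hμ l' (Finset.mem_of_mem_erase hl')) (resid_nonneg u P L hL H μ c hu hμm hc) hk
      have h3 : resid u P L hL H μ c k = c k - u (L.max' hL) k * rowFill u P (L.max' hL) k H c (μ (L.max' hL)) := rfl
      linarith
    · rw [Finset.not_nonempty_iff_eq_empty.1 hL]; simp [hc k hk]

/-- **THE GREEDY IS A CREDIT FLOW** (rates positive on compatible cells, data nonnegative). [this work] -/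
theorem isFlow_flow (hu : ∀ l h, P l h → 0 < u l h) (L H : Finset ℕ) (μ c : ℕ → ℝ)
    (hμ : ∀ l ∈ L, 0 ≤ μ l) (hc : ∀ h ∈ H, 0 ≤ c h) : IsFlow u P L H μ c (flow u P L H μ c) := by
  refine ⟨fun l k => flow_nonneg u P hu L H μ c l k hμ hc, fun l k hlk => ?_,
    fun l hl => sum_flow_row_le u P hu L H μ c l hμ hc hl, fun k hk => sum_mul_flow_col_le u P hu L H μ c k hμ hc hk⟩
  by_contra hnot
  apply hlk
  by_cases h1 : l ∈ L
  · by_cases h2 : k ∈ H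
    · exact flow_eq_zero_of_not_rel u P L H μ c l k (fun h3 => hnot ⟨h1, h2, h3⟩)
    · exact flow_eq_zero_of_not_mem_col u P L H μ c l k h2
  · exact flow_eq_zero_of_not_mem_row u P L H μ c l k h1

/-- **PREFIX PROPERTY**: on the columns `k ≤ t` the greedy flow over `H` coincides with the greedy flow over `H.filter (· ≤ t)`, for
any two capacity functions that agree on the columns `≤ t` of `H`.  (Each row fills lower columns first, so what it puts into the
columns `≤ t`, and the residual capacities there, never depend on the columns `> t`.) [this work] -/
theorem flow_prefix (t : ℕ) : ∀ (L H : Finset ℕ) (μ c c' : ℕ → ℝ) (l k : ℕ), k ≤ t → (∀ h ∈ H, h ≤ t → c h = c' h) →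
    flow u P L H μ c l k = flow u P L (H.filter (· ≤ t)) μ c' l k := by
  intro L
  induction L using Finset.strongInduction with
  | H L ih =>
    intro H μ c c' l k hkt hcc
    by_cases hL : L.Nonempty
    · by_cases hlm : l = L.max' hL
      · rw [hlm, flow_max', flow_max']
        exact rowFill_prefix u P _ t H k c c' _ hkt hcc
      · rw [flow_of_ne_max' u P L H hL μ c l k hlm, flow_of_ne_max' u P L _ hL μ c' l k hlm]
        have key := ih (L.erase (L.max' hL)) (Finset.erase_ssubset (Finset.max'_mem L hL)) H μ
          (resid u P L hL H μ c) (resid u P L hL (H.filter (· ≤ t)) μ c') l k hkt ?_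
        · exact key
        · intro h hh hht
          unfold resid
          rw [hcc h hh hht, rowFill_prefix u P _ t H h c c' _ hht hcc]
    · rw [Finset.not_nonempty_iff_eq_empty.1 hL, flow_empty, flow_empty]

end Greedy
end LawDec
end Quant
end Summit.CriticalPhenomena.PercolationContinuityZ3.Theorems
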